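import Summits.NavierStokesRegularity.FunctionalMining.StretchingLowerFamily
import HarnessLib

/-!
# K1-Q1 lower side in the kernel: the planar family `u_{n,τ}` (part 2: `|ω|²`, the kills, the constants)

Cell `pub-nsfunc` (host summit NavierStokesRegularity, topic `FunctionalMining`), prove seat gen 4, on the
bank seat's blueprint `pub-nsfunc-bank/FourModeWitness-BLUEPRINT.md` §7 / `K1Q1-LOWER.md` §1b.
**Search for candidate a priori estimates; no regularity claim.** Static field facts only.

For the fields `u_{n,τ}` of part 1 (`StretchFamily.u`; production `2π³nτ`, enstrophy `π²(4+(1+n²)τ²)/2`):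
* the nine first derivatives in the two characters `X = e_{e₁}(x)`, `Z = e_{n e₂}(x)` and
  `|ω(x)|² = 4π²(Re Z² + (Re X − τ Im X Im Z)² + n²τ² Re X² Re Z²) ≤ 4π²(2 + n²τ²)` for `τ² ≤ 1`
  (an SOS identity modulo `|X| = |Z| = 1`);
* **`not_stretchingSupBound_of_lt_r`**: for `1 ≤ n`, `0 < τ ≤ 1` and every
  `C < r n τ = 2nτ / (√(2+n²τ²)·(4+(1+n²)τ²))`, `¬ StretchingSupBound C`; hence `r n τ ≤ C⋆`;
* members: `√3/9 ≤ C⋆` (`(n,τ) = (1,1)`, the bank's four-mode field up to `x₁ ↔ x₂` and a factor 2), and the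
  envelope **`√(71 − 17√17)/4 ≤ C⋆`** (`≈ 0.2381`; `τ = λ⋆/n`, `λ⋆² = (√17−1)/2`, `n → ∞`), the bank's best
  hand bound (`K1Q1-LOWER.md` §1b), now kernel-checked. With the tree's `C⋆ ≤ 2/√3` and the no-go seat's
  `¬ StretchingSupSharp` the kernel window for K1-Q1 is `0.2381 ≤ C⋆ < 1.1547`; certified numerics (bank,
  not kernel) give `C⋆ ≥ 0.3299`.
-/

noncomputable section

open MeasureTheory Complex Finset Filter Topology
open scoped RealInnerProductSpace ComplexConjugate

namespace Summit.NavierStokesRegularity.FunctionalMining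

open Literature.Analysis Literature.Analysis.FunctionSpaces Literature.Analysis.FunctionSpaces.Torus
open Literature.Analysis.FluidPDE UnitAddTorus

namespace StretchFamily

variable {n : ℕ} {τ : ℝ}

/-! ## 5. The first derivatives of `u_{n,τ}` in the characters `X = e_{e₁}`, `Z = e_{n e₂}` -/

/-- `|e_k(x)|² = 1` in coordinates. [folklore] -/
private theorem re_sq_add_im_sq (k : Fin 3 → ℤ) (x : UnitAddTorus (Fin 3)) :
    (mFourier k x).re ^ 2 + (mFourier k x).im ^ 2 = 1 := by
  have h : ‖mFourier k x‖ = 1 := by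
    simp only [mFourier, fourier_apply, ContinuousMap.coe_mk, norm_prod, Circle.norm_coe,
      Finset.prod_const_one]
  have h2 : ‖mFourier k x‖ ^ 2 = 1 := by rw [h, one_pow]
  rw [Complex.sq_norm, Complex.normSq_apply] at h2
  nlinarith [h2]

/-- `∂ᵢuⱼ(x) = Re ∑_{k∈S} e_k(x) (2πi kᵢ) ĉ(k)ⱼ`. [folklore] -/
theorem partialDeriv_u_apply (i j : Fin 3) (x : UnitAddTorus (Fin 3)) :
    Torus.partialDeriv i (u n τ) x j =
      (∑ k ∈ S n, mFourier k x * ((2 * Real.pi * Complex.I * (k i : ℂ)) * c n τ k j)).re := by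
  rw [show u n τ = realTrigPoly (S n) (c n τ) from rfl, partialDeriv_realTrigPoly,
    realTrigPoly_apply_coord, trigPoly_apply_coord]
  rfl

/-- The eight wavevectors in terms of `e₁ = V n 1 0` and `n e₂ = V n 0 1`. [ours; bookkeeping] -/
theorem V_table (n : ℕ) :
    V n (-1) 0 = -V n 1 0 ∧ V n 0 (-1) = -V n 0 1 ∧ V n 1 1 = V n 1 0 + V n 0 1 ∧
    V n (-1) (-1) = -(V n 1 0 + V n 0 1) ∧ V n 1 (-1) = V n 1 0 + -V n 0 1 ∧
    V n (-1) 1 = -(V n 1 0 + -V n 0 1) := by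
  simp only [V_add, V_neg]; norm_num

/-- The character `X = e_{e₁}(x)`. [ours; bookkeeping] -/
def X (n : ℕ) (x : UnitAddTorus (Fin 3)) : ℂ := mFourier (V n 1 0) x
/-- The character `Z = e_{n e₂}(x)`. [ours; bookkeeping] -/
def Z (n : ℕ) (x : UnitAddTorus (Fin 3)) : ℂ := mFourier (V n 0 1) x

/-- **The nine first derivatives of `u_{n,τ}`**: `∂₀u₂ = −2π Re X + 2πτ Im X Im Z`,
`∂₁u₀ = −2π Re Z`, `∂₁u₂ = −2πnτ Re X Re Z`, the other six vanish. [ours; elementary] -/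
theorem partialDeriv_table (hn : n ≠ 0) (x : UnitAddTorus (Fin 3)) :
    Torus.partialDeriv 0 (u n τ) x 0 = 0 ∧ Torus.partialDeriv 0 (u n τ) x 1 = 0 ∧
    Torus.partialDeriv 0 (u n τ) x 2 =
      -2 * Real.pi * (X n x).re + 2 * Real.pi * τ * ((X n x).im * (Z n x).im) ∧
    Torus.partialDeriv 1 (u n τ) x 0 = -2 * Real.pi * (Z n x).re ∧
    Torus.partialDeriv 1 (u n τ) x 1 = 0 ∧
    Torus.partialDeriv 1 (u n τ) x 2 = -2 * Real.pi * n * τ * ((X n x).re * (Z n x).re) ∧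
    Torus.partialDeriv 2 (u n τ) x 0 = 0 ∧ Torus.partialDeriv 2 (u n τ) x 1 = 0 ∧
    Torus.partialDeriv 2 (u n τ) x 2 = 0 := by
  have hn' : (n : ℝ) ≠ 0 := by exact_mod_cast hn
  obtain ⟨t1, t2, t3, t4, t5, t6⟩ := V_table n
  refine ⟨?_, ?_, ?_, ?_, ?_, ?_, ?_, ?_, ?_⟩
  all_goals
    rw [partialDeriv_u_apply, sum_S hn, c_p0, c_m0 hn, c_0p hn, c_0m hn, c_pp hn, c_mm hn, c_pm hn,
      c_mp hn]
    simp only [t1, t2, t3, t4, t5, t6, mFourier_neg, mFourier_add, V_apply_zero, V_apply_one,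
      V_apply_two, X, Z]
    simp [Complex.mul_re, Complex.mul_im, Complex.conj_re, Complex.conj_im, Complex.div_re,
      Complex.div_im, Complex.normSq_apply]
  all_goals
    field_simp
    ring

/-! ## 6. `|ω(x)|²` and its sharp bound `4π²(2 + n²τ²)` -/

/-- **`|ω(x)|² = 4π²(Re Z² + (Re X − τ Im X Im Z)² + n²τ² Re X² Re Z²)`** (`ω = 2π(−nτ cos·cos, cos − τ sin·sin, cos)`
in the blueprint's notation). [ours; elementary] -/
theorem torusVorticitySqAt_u (hn : n ≠ 0) (x : UnitAddTorus (Fin 3)) :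
    torusVorticitySqAt (u n τ) x = 4 * Real.pi ^ 2 * ((Z n x).re ^ 2 +
      ((X n x).re - τ * ((X n x).im * (Z n x).im)) ^ 2 + (n : ℝ) ^ 2 * τ ^ 2 * ((X n x).re * (Z n x).re) ^ 2) := by
  obtain ⟨h00, h01, h02, h10, h11, h12, h20, h21, h22⟩ := partialDeriv_table (τ := τ) hn x
  unfold torusVorticitySqAt
  simp only [Fin.sum_univ_three, h00, h01, h02, h10, h11, h12, h20, h21, h22]
  ring

/-- **`|ω(x)|² ≤ 4π²(2 + n²τ²)` for `τ² ≤ 1`**, by the SOS identity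
`(2+n²τ²) − |ω|²/4π² = (Im X + τ Re X Im Z)² + (1−τ²) Im Z² + n²τ² Im X² + n²τ² Re X² Im Z²` modulo
`|X| = |Z| = 1`. [ours; elementary] -/
theorem torusVorticitySqAt_u_le (hn : n ≠ 0) (hτ : τ ^ 2 ≤ 1) (x : UnitAddTorus (Fin 3)) :
    torusVorticitySqAt (u n τ) x ≤ 4 * Real.pi ^ 2 * (2 + (n : ℝ) ^ 2 * τ ^ 2) := by
  rw [torusVorticitySqAt_u hn]
  have hX := re_sq_add_im_sq (V n 1 0) x
  have hZ := re_sq_add_im_sq (V n 0 1) x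
  simp only [X, Z]
  set a := (mFourier (V n 1 0) x).re
  set b := (mFourier (V n 1 0) x).im
  set p := (mFourier (V n 0 1) x).re
  set q := (mFourier (V n 0 1) x).im
  have key : 4 * Real.pi ^ 2 * (2 + (n : ℝ) ^ 2 * τ ^ 2) -
      4 * Real.pi ^ 2 * (p ^ 2 + (a - τ * (b * q)) ^ 2 + (n : ℝ) ^ 2 * τ ^ 2 * (a * p) ^ 2) =
      4 * Real.pi ^ 2 * ((b + τ * a * q) ^ 2 + (1 - τ ^ 2) * q ^ 2 + (n : ℝ) ^ 2 * τ ^ 2 * b ^ 2 +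
        (n : ℝ) ^ 2 * τ ^ 2 * a ^ 2 * q ^ 2) := by
    linear_combination (-4 * Real.pi ^ 2 * (1 + τ ^ 2 * q ^ 2 + (n : ℝ) ^ 2 * τ ^ 2)) * hX +
      (-4 * Real.pi ^ 2 * (1 + (n : ℝ) ^ 2 * τ ^ 2 * a ^ 2)) * hZ
  have h1 : 0 ≤ 1 - τ ^ 2 := sub_nonneg.2 hτ
  have hnn : 0 ≤ 4 * Real.pi ^ 2 * ((b + τ * a * q) ^ 2 + (1 - τ ^ 2) * q ^ 2 +
      (n : ℝ) ^ 2 * τ ^ 2 * b ^ 2 + (n : ℝ) ^ 2 * τ ^ 2 * a ^ 2 * q ^ 2) := by positivity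
  linarith

/-! ## 7. The kills: `¬ StretchingSupBound C` for `C < r n τ` -/

/-- The family's stretching ratio `r(n,τ) = N/(M·ℰ) = 2nτ / (√(2+n²τ²)·(4+(1+n²)τ²))`. [ours] -/
def r (n : ℕ) (τ : ℝ) : ℝ :=
  2 * n * τ / (Real.sqrt (2 + (n : ℝ) ^ 2 * τ ^ 2) * (4 + (1 + (n : ℝ) ^ 2) * τ ^ 2))

/-- **K1-Q1 kernel kills along the family**: for `1 ≤ n`, `0 < τ ≤ 1` and `C < r n τ` the static
sup-stretching bound with constant `C` fails at `u_{n,τ}` (`M = 2π√(2+n²τ²)` is admissible and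
`2π³nτ ≤ C·M·π²(4+(1+n²)τ²)/2` is false). Search for candidate a priori estimates; no regularity claim.
[ours] -/
theorem not_stretchingSupBound_of_lt_r (hn : 1 ≤ n) (hτ : 0 < τ) (hτ1 : τ ≤ 1) {C : ℝ}
    (hC : C < r n τ) : ¬ StretchingSupBound (d := Fin 3) C := by
  intro h
  have hn0 : n ≠ 0 := by omega
  have hpi := Real.pi_pos
  have hτ2 : τ ^ 2 ≤ 1 := by nlinarith
  have hD1 : 0 < 2 + (n : ℝ) ^ 2 * τ ^ 2 := by positivity
  obtain ⟨M, hM⟩ : ∃ M, M = 2 * Real.pi * Real.sqrt (2 + (n : ℝ) ^ 2 * τ ^ 2) := ⟨_, rfl⟩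
  have hM0 : 0 ≤ M := by rw [hM]; positivity
  have hM2 : M ^ 2 = 4 * Real.pi ^ 2 * (2 + (n : ℝ) ^ 2 * τ ^ 2) := by
    rw [hM, mul_pow, Real.sq_sqrt hD1.le]; ring
  have hω : ∀ x, torusVorticitySqAt (u n τ) x ≤ M ^ 2 := fun x => by
    rw [hM2]; exact torusVorticitySqAt_u_le hn0 hτ2 x
  have hle := h (Fintype.card_fin 3) (u n τ) isSmooth_u (isDivFree_u hn0) M hM0 hω
  rw [enstrophyProduction_u hn0, torusEnstrophy_u hn0, hM] at hle
  -- `hle : 2π³nτ ≤ C · 2π√(2+n²τ²) · π²(4+(1+n²)τ²)/2`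
  have hD : 0 < Real.sqrt (2 + (n : ℝ) ^ 2 * τ ^ 2) * (4 + (1 + (n : ℝ) ^ 2) * τ ^ 2) := by positivity
  have h3 : 0 < Real.pi ^ 3 := by positivity
  have key : Real.pi ^ 3 * (2 * n * τ -
      C * (Real.sqrt (2 + (n : ℝ) ^ 2 * τ ^ 2) * (4 + (1 + (n : ℝ) ^ 2) * τ ^ 2))) ≤ 0 := by
    nlinarith [hle]
  have key' : 2 * n * τ - C * (Real.sqrt (2 + (n : ℝ) ^ 2 * τ ^ 2) * (4 + (1 + (n : ℝ) ^ 2) * τ ^ 2)) ≤ 0 := by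
    by_contra hcon
    exact absurd key (not_le.2 (mul_pos h3 (lt_of_not_ge hcon)))
  have hrC : r n τ ≤ C := by
    rw [r, div_le_iff₀ hD]; linarith
  linarith

/-- **`r n τ ≤ C⋆`** for every member of the family (`1 ≤ n`, `0 < τ ≤ 1`). [ours] -/
theorem r_le_stretchingSupConst (hn : 1 ≤ n) (hτ : 0 < τ) (hτ1 : τ ≤ 1) :
    r n τ ≤ stretchingSupConst (d := Fin 3) :=
  le_of_forall_lt_imp_le_of_dense fun _ hC => le_stretchingSupConst (not_stretchingSupBound_of_lt_r hn hτ hτ1 hC)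

/-! ## 8. The constants: `√3/9` (one field) and the envelope `√(71 − 17√17)/4` -/

/-- `r 1 1 = √3/9` (`= 2/(6√3)`). [ours; elementary] -/
theorem r_one_one : r 1 1 = Real.sqrt 3 / 9 := by
  have h3 : Real.sqrt 3 * Real.sqrt 3 = 3 := Real.mul_self_sqrt (by norm_num)
  have hs : 0 < Real.sqrt 3 := by positivity
  rw [r, Nat.cast_one, show (2 : ℝ) + 1 ^ 2 * 1 ^ 2 = 3 by norm_num]
  rw [div_eq_div_iff (by positivity) (by norm_num)]
  nlinarith [h3]

/-- **`StretchingSupBound C` fails for every `C < √3/9 ≈ 0.192`** (the member `(n,τ) = (1,1)`: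
`u = (−sin 2πx₂, 0, −sin 2πx₁ − cos 2πx₁ sin 2πx₂)`, production `2π³`, enstrophy `3π²`, `|ω|² ≤ 12π²`;
the bank's four-mode field is `2u` with `x₁ ↔ x₂`). Search for candidate a priori estimates; no
regularity claim. [ours] -/
theorem not_stretchingSupBound_of_lt_sqrt_three_div_nine {C : ℝ} (hC : C < Real.sqrt 3 / 9) :
    ¬ StretchingSupBound (d := Fin 3) C :=
  not_stretchingSupBound_of_lt_r (n := 1) (τ := 1) le_rfl one_pos le_rfl (by rwa [r_one_one])

/-- **`√3/9 ≤ C⋆`.** [ours] -/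
theorem sqrt_three_div_nine_le_stretchingSupConst : Real.sqrt 3 / 9 ≤ stretchingSupConst (d := Fin 3) := by
  rw [← r_one_one]; exact r_le_stretchingSupConst le_rfl one_pos le_rfl

/-- `λ⋆ = √((√17 − 1)/2) ≈ 1.2496`, the optimal `nτ` along the family as `n → ∞`. [ours; bookkeeping] -/
def lamStar : ℝ := Real.sqrt ((Real.sqrt 17 - 1) / 2)

/-- The envelope constant `2λ⋆ / (√(2+λ⋆²)·(4+λ⋆²))` (`= lim_{n→∞} r n (λ⋆/n) = sup of the family`).
[ours; bookkeeping] -/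
def envelopeConst : ℝ :=
  2 * lamStar / (Real.sqrt (2 + (Real.sqrt 17 - 1) / 2) * (4 + (Real.sqrt 17 - 1) / 2))

/-- `1 < √17 ≤ 71/17` (so `λ⋆ > 0` and `71 − 17√17 ≥ 0`). [ours; elementary] -/
theorem sqrt_seventeen_bounds : 1 < Real.sqrt 17 ∧ Real.sqrt 17 ≤ 71 / 17 := by
  constructor
  · rw [show (1 : ℝ) = Real.sqrt 1 by simp]
    exact Real.sqrt_lt_sqrt (by norm_num) (by norm_num)
  · rw [show (71 / 17 : ℝ) = Real.sqrt ((71 / 17) ^ 2) by rw [Real.sqrt_sq]; norm_num]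
    exact Real.sqrt_le_sqrt (by norm_num)

/-- `0 < λ⋆ ≤ 2` and `λ⋆² = (√17 − 1)/2`. [ours; elementary] -/
theorem lamStar_facts : 0 < lamStar ∧ lamStar ≤ 2 ∧ lamStar ^ 2 = (Real.sqrt 17 - 1) / 2 := by
  obtain ⟨h1, h2⟩ := sqrt_seventeen_bounds
  have hμ : 0 < (Real.sqrt 17 - 1) / 2 := by linarith
  refine ⟨Real.sqrt_pos.2 hμ, ?_, Real.sq_sqrt hμ.le⟩
  rw [lamStar, show (2 : ℝ) = Real.sqrt (2 ^ 2) by rw [Real.sqrt_sq]; norm_num]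
  exact Real.sqrt_le_sqrt (by linarith)

/-- Along `τ = λ⋆/n`: `r n (λ⋆/n) = 2λ⋆ / (√(2+λ⋆²)·(4 + λ⋆² + λ⋆²/n²))`. [ours; elementary] -/
theorem r_lamStar_div (hn : n ≠ 0) :
    r n (lamStar / n) = 2 * lamStar / (Real.sqrt (2 + (Real.sqrt 17 - 1) / 2) *
      (4 + (Real.sqrt 17 - 1) / 2 + (Real.sqrt 17 - 1) / 2 / (n : ℝ) ^ 2)) := by
  obtain ⟨_, _, hsq⟩ := lamStar_facts
  have hn' : (n : ℝ) ≠ 0 := by exact_mod_cast hn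
  have e1 : (n : ℝ) ^ 2 * (lamStar / n) ^ 2 = (Real.sqrt 17 - 1) / 2 := by
    rw [div_pow, ← hsq]; field_simp
  have e2 : (1 + (n : ℝ) ^ 2) * (lamStar / n) ^ 2 =
      (Real.sqrt 17 - 1) / 2 + (Real.sqrt 17 - 1) / 2 / (n : ℝ) ^ 2 := by
    rw [div_pow, ← hsq]; field_simp; ring
  have e3 : (2 : ℝ) * n * (lamStar / n) = 2 * lamStar := by field_simp
  rw [r, e1, e2, e3]
  ring_nf

/-- `r n (λ⋆/n) → envelopeConst` as `n → ∞`. [ours; elementary] -/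
theorem tendsto_r_lamStar : Tendsto (fun n : ℕ => r n (lamStar / n)) atTop (𝓝 envelopeConst) := by
  obtain ⟨h1, _⟩ := sqrt_seventeen_bounds
  have hμ : 0 < (Real.sqrt 17 - 1) / 2 := by linarith
  have h0 : Tendsto (fun n : ℕ => (Real.sqrt 17 - 1) / 2 / (n : ℝ) ^ 2) atTop (𝓝 0) :=
    tendsto_const_nhds.div_atTop ((tendsto_pow_atTop two_ne_zero).comp tendsto_natCast_atTop_atTop)
  have hlim : Tendsto ((fun _ : ℕ => 2 * lamStar) / fun n : ℕ => Real.sqrt (2 + (Real.sqrt 17 - 1) / 2) *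
      (4 + (Real.sqrt 17 - 1) / 2 + (Real.sqrt 17 - 1) / 2 / (n : ℝ) ^ 2)) atTop (𝓝 envelopeConst) := by
    have h := (tendsto_const_nhds (x := 2 * lamStar)).div
      ((tendsto_const_nhds (x := Real.sqrt (2 + (Real.sqrt 17 - 1) / 2))).mul
        ((tendsto_const_nhds (x := 4 + (Real.sqrt 17 - 1) / 2)).add h0))
      (by rw [add_zero]; positivity)
    rw [add_zero] at h
    exact h
  refine hlim.congr' ?_
  filter_upwards [eventually_ge_atTop 1] with n hn
  rw [Pi.div_apply]
  exact (r_lamStar_div (by omega)).symm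

/-- **The envelope of the family is below `C⋆`: `envelopeConst ≤ stretchingSupConst`** (`r n (λ⋆/n) ≤ C⋆`
for `n ≥ 2`, where `λ⋆/n ≤ 1`, and pass to the limit). Search for candidate a priori estimates; no
regularity claim. [ours] -/
theorem envelopeConst_le_stretchingSupConst : envelopeConst ≤ stretchingSupConst (d := Fin 3) := by
  obtain ⟨hl0, hl2, _⟩ := lamStar_facts
  refine le_of_tendsto tendsto_r_lamStar (eventually_atTop.2 ⟨2, fun n hn => ?_⟩)
  have hn' : (2 : ℝ) ≤ n := by exact_mod_cast hn
  have hnpos : (0 : ℝ) < n := by linarith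
  exact r_le_stretchingSupConst (by omega) (div_pos hl0 hnpos)
    ((div_le_one hnpos).2 (hl2.trans hn'))

/-- **Closed form of the envelope: `envelopeConst = √(71 − 17√17)/4 ≈ 0.2381`** (square both sides; a
polynomial identity in `s = √17` modulo `s² = 17`). [ours; elementary] -/
theorem envelopeConst_eq : envelopeConst = Real.sqrt (71 - 17 * Real.sqrt 17) / 4 := by
  obtain ⟨h1, h2⟩ := sqrt_seventeen_bounds
  obtain ⟨hl0, _, hsq⟩ := lamStar_facts
  have hs : Real.sqrt 17 ^ 2 = 17 := Real.sq_sqrt (by norm_num)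
  have hμ : 0 < (Real.sqrt 17 - 1) / 2 := by linarith
  have h71 : 0 ≤ 71 - 17 * Real.sqrt 17 := by linarith
  have hL : 0 ≤ envelopeConst := by unfold envelopeConst; positivity
  have hR : 0 ≤ Real.sqrt (71 - 17 * Real.sqrt 17) / 4 := by positivity
  refine (pow_left_inj₀ hL hR two_ne_zero).1 ?_
  have hA : 0 < Real.sqrt (2 + (Real.sqrt 17 - 1) / 2) * (4 + (Real.sqrt 17 - 1) / 2) := by positivity
  rw [envelopeConst, div_pow, div_pow, mul_pow, mul_pow, hsq, Real.sq_sqrt (by linarith), Real.sq_sqrt h71,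
    div_eq_div_iff (by positivity) (by norm_num)]
  linear_combination ((17 * Real.sqrt 17 ^ 2 + 218 * Real.sqrt 17 + 629) / 8) * hs

/-- **`√(71 − 17√17)/4 ≤ C⋆`** — the bank seat's best hand lower bound for the sharp sup-stretching constant
(`K1Q1-LOWER.md` §1b), kernel-checked; with `stretchingSupConst_le_holder`: `0.2381 ≤ C⋆ ≤ 1.1547`.
Search for candidate a priori estimates; no regularity claim. [ours] -/
theorem sqrt_envelope_le_stretchingSupConst :
    Real.sqrt (71 - 17 * Real.sqrt 17) / 4 ≤ stretchingSupConst (d := Fin 3) := by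
  rw [← envelopeConst_eq]; exact envelopeConst_le_stretchingSupConst

end StretchFamily

end Summit.NavierStokesRegularity.FunctionalMining

end
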